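import Summits.AtomisticToContinuum.Crystallization.Theorems.FrustratedLawDichotomyTextureUniformVerdict

/-!
# FrustratedLawDichotomy · crux `AperiodicFrustratedLawGap` (stmt-AtomisticToContinuum-27623) — FROM (UV) TO «SOME ATOM IS INCOHERENT»: the matched form of (FLIP) and the a.s. lift
# (decomp-a2c hand-2 g45, STRUCTURAL share #58: DEF-FREE; the logic around lens-5 g111's geometric layer (FLIP), critic r1702 (B)(3))

`not_coherent_of_texBall` = (UV) ∘ (FLIP).  (UV) is in the tree (`…TextureUniformVerdict`).  This file fixes, with NO new definitions and NO geometry,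
WHAT (FLIP) HAS TO DELIVER and performs the remaining logic and the lift to laws, so that the texture door's `htex`
(`…SignedLedgerTextureDoor.aperiodicFrustratedLawGap_of_texture_and_defectDensity`) becomes «(FLIP) + bookkeeping»:

* ★ `exists_incoherent_atom_of_apprM` — deterministic, per configuration.  INPUT: the named texture matching `ApprM μ R₇ R₈ R₉` (verbatim the crux's `Appr`),
  an atom at the root (`μ {0} ≠ 0`), radii `0 ≤ R`, `R₉ ≤ R`, `R₈ ≤ ρ`, `R₉ ≤ ρ`, a tolerance `ε > 0`,
  ANY coherence predicate `Coh : (EuclideanSpace ℝ (Fin 3)) → Prop` on atoms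
  (e.g. `Coh p := θ_p μ ∈ C`) and ★ the MATCHED FLIP HYPOTHESIS `hflip`: «if every atom `p` of `μ` with `‖p‖ ≤ R'` is coherent, then every `7/10`-separated
  finite configuration two-way `ε`-matching the `R`-ball of `μ` at the root has a UNIFORM `1/8`-verdict on its `ρ`-ball about the centre».  OUTPUT: an atom
  `p`, `‖p‖ ≤ R'`, which is NOT coherent.  (Proof: the textured matching ball from `ApprM` would be uniform by `hflip`, contradicting (UV).)
* `exists_incoherent_reroot_of_apprM` — the same with `Coh p := Measure.map (· − p) μ ∈ C`.
* ★ `ae_exists_incoherent_reroot` — the LAW-LEVEL lift: a law a.s. rooted `δ`-hard-core and a.s. `ApprM · R₇ R₈ R₉` whose a.e. configuration satisfies the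
  matched FLIP hypothesis yields `∀ᵐ μ ∂P, ∃ p, μ {p} ≠ 0 ∧ θ_p μ ∉ C` — literally the `htex` premise of the texture door (no measurability of `C` needed
  here; the door needs it for `hdef`'s density).

So lens-5 g111's (FLIP) may be proved in exactly the shape of `hflip` (coherent atoms near the root ⇒ uniform verdict of every matching textured ball),
with its explicit `ε₀(L, τ₀)`, `R'`, `ρ`; nothing else stands between (FLIP) and `htex`.  Tags: [folklore: logic].
-/

noncomputable section

namespace Summit.AtomisticToContinuum.Crystallization.Theorems.FrustratedLawDichotomyTextureIncoherence

open MeasureTheory Metric Set Filter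
open scoped ENNReal
open Literature.Probability.Process
open Summit.AtomisticToContinuum.Crystallization.Theorems.RepetitiveNetworkReductionRecurrentMember (Gy TexBall ApprM)
open Summit.AtomisticToContinuum.Crystallization.Theorems.FrustratedLawDichotomyTextureUniformVerdict (not_uniformVerdict_of_texBall)

variable {R₇ R₈ R₉ : ℝ}

/-- ★ **FROM (UV) AND THE MATCHED (FLIP) TO AN INCOHERENT ATOM** (deterministic).  See the module docstring for the reading of `hflip`.
[folklore: logic] -/
theorem exists_incoherent_atom_of_apprM {μ : Measure (EuclideanSpace ℝ (Fin 3))} (happr : ApprM μ R₇ R₈ R₉) (h0 : μ {0} ≠ 0)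
    {R ρ R' ε : ℝ} (hR : 0 ≤ R) (hR₉ : R₉ ≤ R) (hρ₈ : R₈ ≤ ρ) (hρ₉ : R₉ ≤ ρ) (hε : 0 < ε) (Coh : (EuclideanSpace ℝ (Fin 3)) → Prop)
    (hflip : (∀ p : (EuclideanSpace ℝ (Fin 3)), μ {p} ≠ 0 → ‖p‖ ≤ R' → Coh p) →
      ∀ (N : ℕ) (y : Fin N → (EuclideanSpace ℝ (Fin 3))) (i : Fin N), (∀ a b : Fin N, a ≠ b → (7 : ℝ) / 10 ≤ dist (y a) (y b)) →
        (∀ p : (EuclideanSpace ℝ (Fin 3)), μ {p} ≠ 0 → dist p 0 ≤ R → ∃ k : Fin N, dist (y k - y i) (p - 0) ≤ ε) →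
        (∀ k : Fin N, dist (y k) (y i) ≤ R → ∃ p : (EuclideanSpace ℝ (Fin 3)), μ {p} ≠ 0 ∧ dist (y k - y i) (p - 0) ≤ ε) →
        (∀ j : Fin N, dist (y j) (y i) ≤ ρ → Gy (1 / 8) N y j) ∨ (∀ j : Fin N, dist (y j) (y i) ≤ ρ → ¬ Gy (1 / 8) N y j)) :
    ∃ p : (EuclideanSpace ℝ (Fin 3)), μ {p} ≠ 0 ∧ ‖p‖ ≤ R' ∧ ¬ Coh p := by
  by_contra hno
  have hall : ∀ p : (EuclideanSpace ℝ (Fin 3)), μ {p} ≠ 0 → ‖p‖ ≤ R' → Coh p := by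
    intro p hp hpR
    by_contra hc
    exact hno ⟨p, hp, hpR, hc⟩
  obtain ⟨N, y, i, htex, hfwd, hbwd⟩ := happr 0 h0 R ε hε
  have hsep : ∀ a b : Fin N, a ≠ b → (7 : ℝ) / 10 ≤ dist (y a) (y b) := htex.1
  obtain ⟨hng, hnb⟩ := not_uniformVerdict_of_texBall htex hR hR₉ hρ₈ hρ₉
  rcases hflip hall N y i hsep hfwd hbwd with h | h
  · exact hng h
  · exact hnb h

/-- **The re-rooting form**: `Coh p := θ_p μ ∈ C`. [folklore: logic] -/
theorem exists_incoherent_reroot_of_apprM {μ : Measure (EuclideanSpace ℝ (Fin 3))} (happr : ApprM μ R₇ R₈ R₉) (h0 : μ {0} ≠ 0)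
    {R ρ R' ε : ℝ} (hR : 0 ≤ R) (hR₉ : R₉ ≤ R) (hρ₈ : R₈ ≤ ρ) (hρ₉ : R₉ ≤ ρ) (hε : 0 < ε) (C : Set (Measure (EuclideanSpace ℝ (Fin 3))))
    (hflip : (∀ p : (EuclideanSpace ℝ (Fin 3)), μ {p} ≠ 0 → ‖p‖ ≤ R' → Measure.map (fun z : (EuclideanSpace ℝ (Fin 3)) => z - p) μ ∈ C) →
      ∀ (N : ℕ) (y : Fin N → (EuclideanSpace ℝ (Fin 3))) (i : Fin N), (∀ a b : Fin N, a ≠ b → (7 : ℝ) / 10 ≤ dist (y a) (y b)) →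
        (∀ p : (EuclideanSpace ℝ (Fin 3)), μ {p} ≠ 0 → dist p 0 ≤ R → ∃ k : Fin N, dist (y k - y i) (p - 0) ≤ ε) →
        (∀ k : Fin N, dist (y k) (y i) ≤ R → ∃ p : (EuclideanSpace ℝ (Fin 3)), μ {p} ≠ 0 ∧ dist (y k - y i) (p - 0) ≤ ε) →
        (∀ j : Fin N, dist (y j) (y i) ≤ ρ → Gy (1 / 8) N y j) ∨ (∀ j : Fin N, dist (y j) (y i) ≤ ρ → ¬ Gy (1 / 8) N y j)) :
    ∃ p : (EuclideanSpace ℝ (Fin 3)), μ {p} ≠ 0 ∧ Measure.map (fun z : (EuclideanSpace ℝ (Fin 3)) => z - p) μ ∉ C := by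
  obtain ⟨p, hp, -, hc⟩ := exists_incoherent_atom_of_apprM happr h0 hR hR₉ hρ₈ hρ₉ hε
    (fun p => Measure.map (fun z : (EuclideanSpace ℝ (Fin 3)) => z - p) μ ∈ C) hflip
  exact ⟨p, hp, hc⟩

/-- ★ **THE A.S. LIFT** — the `htex` premise of the texture door from (FLIP) in matched form: a law a.s. rooted `δ`-hard-core and a.s. texture-matched
(`ApprM`, verbatim the crux's `Appr`) whose almost every configuration satisfies the matched FLIP hypothesis (radii `0 ≤ R`, `R₉ ≤ R`, `R₈, R₉ ≤ ρ`,
tolerance `ε > 0`, any `R'`) has, almost surely, SOME atom whose re-rooting leaves `C`. [folklore: logic] -/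
theorem ae_exists_incoherent_reroot {δ : ℝ} {P : Measure (Measure (EuclideanSpace ℝ (Fin 3)))} (hcore : ∀ᵐ μ ∂P, IsRootedHardCore δ μ)
    (happr : ∀ᵐ μ ∂P, ApprM μ R₇ R₈ R₉) {R ρ R' ε : ℝ} (hR : 0 ≤ R) (hR₉ : R₉ ≤ R) (hρ₈ : R₈ ≤ ρ) (hρ₉ : R₉ ≤ ρ)
    (hε : 0 < ε) (C : Set (Measure (EuclideanSpace ℝ (Fin 3))))
    (hflip : ∀ᵐ μ ∂P, (∀ p : (EuclideanSpace ℝ (Fin 3)), μ {p} ≠ 0 → ‖p‖ ≤ R' → Measure.map (fun z : (EuclideanSpace ℝ (Fin 3)) => z - p) μ ∈ C) →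
      ∀ (N : ℕ) (y : Fin N → (EuclideanSpace ℝ (Fin 3))) (i : Fin N), (∀ a b : Fin N, a ≠ b → (7 : ℝ) / 10 ≤ dist (y a) (y b)) →
        (∀ p : (EuclideanSpace ℝ (Fin 3)), μ {p} ≠ 0 → dist p 0 ≤ R → ∃ k : Fin N, dist (y k - y i) (p - 0) ≤ ε) →
        (∀ k : Fin N, dist (y k) (y i) ≤ R → ∃ p : (EuclideanSpace ℝ (Fin 3)), μ {p} ≠ 0 ∧ dist (y k - y i) (p - 0) ≤ ε) →
        (∀ j : Fin N, dist (y j) (y i) ≤ ρ → Gy (1 / 8) N y j) ∨ (∀ j : Fin N, dist (y j) (y i) ≤ ρ → ¬ Gy (1 / 8) N y j)) :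
    ∀ᵐ μ ∂P, ∃ p : (EuclideanSpace ℝ (Fin 3)), μ {p} ≠ 0 ∧ Measure.map (fun z : (EuclideanSpace ℝ (Fin 3)) => z - p) μ ∉ C := by
  filter_upwards [hcore, happr, hflip] with μ hμ hap hfl
  have h0 : μ {0} ≠ 0 := by rw [hμ.measure_zero_singleton]; exact one_ne_zero
  exact exists_incoherent_reroot_of_apprM hap h0 hR hR₉ hρ₈ hρ₉ hε C hfl

end Summit.AtomisticToContinuum.Crystallization.Theorems.FrustratedLawDichotomyTextureIncoherence

end
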